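import Summits.Parity.GeneralizedHardyLittlewood.Theorems.BeyondDiagonalBeatsQuarter.OffDiagBoxTransformRegularity
import Summits.Parity.GeneralizedHardyLittlewood.Theorems.BeyondDiagonalBeatsQuarter.OffDiagSliceTransformBounds
import HarnessLib

/-!
# Route `PrimeLevelFamEdge`, crux K_B (stmt-Parity-20343), line `diagonal_kernel_split` rev 4, plan Ω,
# a8P closable principal piece (input I1 of `OffDiagPrincipalClosableTotal`, part 3) — **the sample weight
# `F(u) = 𝓕(t₁ ↦ Φ_{i,u}(t₁, y₂))(ξ)` is bounded and Lipschitz in `u`, uniformly in `(ξ, y₂)`**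

Instantiates the generic transport `OffDiagSliceTransformBounds` with the `u`-regularity of
`OffDiagBoxTransformRegularity` (`K₁ = 2^{i₁}`, support `t₁ ∈ [K₁/2, 2K₁]` of length `3K₁/2`):

* `continuous_boxWeightU_slice`, `boxWeightU_slice_eq_zero_of_not_mem` — plumbing;
* **`norm_fourier_boxWeightU_le`** — `‖F u‖ ≤ S₀·(3K₁/2)` for all `u`, `S₀ = (d₁d₂K₁K₂/4)^{−1/2}·W(X/4)·c⁻¹`;
* **`norm_fourier_boxWeightU_sub_le`** — `‖F u − F u′‖ ≤ (2π·S₁/(q·c·√u₀))·|u − u′|·(3K₁/2)` for `u, u′ ≥ u₀ > 0`,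
  `S₁ = (d₁d₂)^{−1/2}·W(X/4)·c⁻¹` — the `(B, K)` data of `MellinBumpPhase`/`mellinBump_xsq_e` for the real and
  imaginary parts of `u ↦ F(u)` on any window `u ≥ u₀` (the window cutoff `ρ` is the consumer's).

Absolute values only; theorems only; standard axioms. Helper toward `stub_offDiagBelowSlack_io`
(`--supports stmt-Parity-20343`); closes nothing.
«The programme SEARCHES and TYPES; no claim about Landau–Siegel zeros, Theorems 1–2 of arXiv:2211.02515 or
a repaired Margin232 until a kernel theorem says so.»
-/

noncomputable section

open Set MeasureTheory
open scoped Real FourierTransform ContDiff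

namespace Summit.Parity.GeneralizedHardyLittlewood.Theorems.BeyondDiagonalBeatsQuarter.OffDiag

open Literature.NumberTheory.LFunctions Literature.NumberTheory.LFunctions.KMV2000

variable {q d₁ d₂ c : ℕ}

/-- The `t₁`-slice of `Φ_{i,u}` at height `y₂` is continuous (`u > 0`). [folklore] -/
theorem continuous_boxWeightU_slice [NeZero q] (hd₁ : 1 ≤ d₁) (hd₂ : 1 ≤ d₂) {u : ℝ} (hu : 0 < u)
    (i : ℕ × ℕ) (y₂ : ℝ) : Continuous fun t₁ : ℝ ↦ boxWeightU q d₁ d₂ u c i t₁ y₂ :=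
  continuous_slice_left (contDiff_uncurry_boxWeightU (c := c) hd₁ hd₂ hu i).continuous y₂

/-- The `t₁`-slice vanishes off `[2^{i₁}/2, 2·2^{i₁}]`. [folklore] -/
theorem boxWeightU_slice_eq_zero_of_not_mem (u : ℝ) (i : ℕ × ℕ) (y₂ : ℝ) :
    ∀ t₁ : ℝ, t₁ ∉ Icc ((2 : ℝ) ^ i.1 / 2) (2 * 2 ^ i.1) → boxWeightU q d₁ d₂ u c i t₁ y₂ = 0 :=
  fun _ ht ↦ boxWeightU_eq_zero_of_not_mem u (fun h ↦ ht h.1)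

/-- **The sample weight is bounded, uniformly in `u`, `ξ`, `y₂`:**
`‖𝓕(t₁ ↦ Φ_{i,u}(t₁,y₂))(ξ)‖ ≤ S₀·(2·2^{i₁} − 2^{i₁}/2)`, `S₀ = (d₁d₂K₁K₂/4)^{−1/2}·W(d₁d₂K₁K₂/(4q̂²))·c⁻¹`.
[folklore] -/
theorem norm_fourier_boxWeightU_le [NeZero q] (hd₁ : 1 ≤ d₁) (hd₂ : 1 ≤ d₂) (u : ℝ) (i : ℕ × ℕ)
    (y₂ ξ : ℝ) :
    ‖𝓕 (fun t₁ : ℝ ↦ boxWeightU q d₁ d₂ u c i t₁ y₂) ξ‖ ≤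
      ((d₁ : ℝ) * d₂ * ((2 : ℝ) ^ i.1 * 2 ^ i.2) / 4) ^ (-(1 / 2 : ℝ)) *
          cutoffW ((d₁ : ℝ) * d₂ * ((2 : ℝ) ^ i.1 * 2 ^ i.2) / 4 / qhat q ^ 2) * (c : ℝ)⁻¹ *
        (2 * 2 ^ i.1 - 2 ^ i.1 / 2) :=
  norm_fourier_le_of_norm_le_of_support
    (by have : (0 : ℝ) < 2 ^ i.1 := by positivity
        linarith)
    (fun t₁ ↦ norm_boxWeightU_le hd₁ hd₂ u i t₁ y₂) (boxWeightU_slice_eq_zero_of_not_mem u i y₂) ξ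

/-- **The sample weight is Lipschitz in `u`, uniformly in `ξ`, `y₂`:** for `c ≥ 1`, `u, u′ ≥ u₀ > 0`:
`‖𝓕(t₁ ↦ Φ_{i,u}(t₁,y₂))(ξ) − 𝓕(t₁ ↦ Φ_{i,u′}(t₁,y₂))(ξ)‖ ≤ (2π·S₁/(q·c·√u₀))·|u − u′|·(2·2^{i₁} − 2^{i₁}/2)`,
`S₁ = (d₁d₂)^{−1/2}·W(d₁d₂K₁K₂/(4q̂²))·c⁻¹`. [folklore] -/
theorem norm_fourier_boxWeightU_sub_le [NeZero q] (hd₁ : 1 ≤ d₁) (hd₂ : 1 ≤ d₂) (hc : 1 ≤ c) (i : ℕ × ℕ)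
    {u₀ u u' : ℝ} (hu₀ : 0 < u₀) (hu : u₀ ≤ u) (hu' : u₀ ≤ u') (y₂ ξ : ℝ) :
    ‖𝓕 (fun t₁ : ℝ ↦ boxWeightU q d₁ d₂ u c i t₁ y₂) ξ -
        𝓕 (fun t₁ : ℝ ↦ boxWeightU q d₁ d₂ u' c i t₁ y₂) ξ‖ ≤
      2 * π * (((d₁ : ℝ) * d₂) ^ (-(1 / 2 : ℝ)) *
            cutoffW ((d₁ : ℝ) * d₂ * ((2 : ℝ) ^ i.1 * 2 ^ i.2) / 4 / qhat q ^ 2) * (c : ℝ)⁻¹) /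
          ((q : ℝ) * c * Real.sqrt u₀) * |u - u'| * (2 * 2 ^ i.1 - 2 ^ i.1 / 2) :=
  norm_fourier_sub_le_of_norm_sub_le
    (by have : (0 : ℝ) < 2 ^ i.1 := by positivity
        linarith)
    (continuous_boxWeightU_slice hd₁ hd₂ (lt_of_lt_of_le hu₀ hu) i y₂)
    (continuous_boxWeightU_slice hd₁ hd₂ (lt_of_lt_of_le hu₀ hu') i y₂)
    (boxWeightU_slice_eq_zero_of_not_mem u i y₂) (boxWeightU_slice_eq_zero_of_not_mem u' i y₂)
    (fun t₁ ↦ norm_boxWeightU_sub_le hd₁ hd₂ hc i hu₀ hu hu' t₁ y₂) ξ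

end Summit.Parity.GeneralizedHardyLittlewood.Theorems.BeyondDiagonalBeatsQuarter.OffDiag
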